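import Summits.BirchSwinnertonDyer.Rank1Residual.Additive.RamifiedSevenGenusKummerTwistLifts
import Summits.BirchSwinnertonDyer.Rank1Residual.Additive.RamifiedSevenGenusResidueTwistedSum
import HarnessLib

/-!
# `𝒞₇` genus road (crux `EllipticUnitValueSevenOfGZK`, K7r), row K2C-12 = (B2′) KUMMER NON-VANISHING, File TWb:
# THE LEVEL-INDEPENDENT TWIST FAMILY over `Γ_K/H₀` — the unit weight `Σ k_δ η₁(υ_δ) ≡ [Γ_K : H₀] ≢ 0 (7)`, the packaged twist
# data, and the twisted sum `x′` read on `𝓤_{F′ₙ}`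

Cell bsd-cm, seat bsd-cm-k-ty1 g32; pen START packet `bsd-cm-plan/g38/START-kty1-g32.md` §2; ruling D1082.  Sequel of
`RamifiedSevenGenusKummerTwistLifts.lean` (TWa; same setting and notation).  The twisted norm of (B2′) (Kato §15.14) is indexed ONCE FOR ALL
LEVELS by `δ ∈ ι = Γ_K/H₀` (`H₀ = Gal(K̄/e⁻¹F′₀)`), which is what makes Kőnig's lemma (File T3) applicable in L5b:
* `isUnit_sum_weights`: with `k_δ = b_δ c_δ` (`b_δ a_δ ≡ 1`, `c_δ ≡ χ_D(a_δ)ω(a_δ)⁵`) every term `k_δ η₁(υ_δ)` is `≡ (a_δ|7) = 1 (7)` (Euler's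
  criterion; `(a_δ|7) = 1` by A2a), so the weight is `≡ #ι ≢ 0` — a unit of `ℤ₇` (L5a's `hunit`);
* ★★★ `exists_twistData`: representatives `t n δ ∈ Uₙ` of every class `δ` at every level, exponents `a_δ` of the canonical representatives
  on `ζ′₀`, inverses, weights, torsion lifts `υ_δ` with `η₁(υ_δ) = χ_D(a_δ)ω(a_δ)⁵`, the unit weight ((A2) of A2b: `7 ∤ [Γ_K:H₀]`), and the
  AGREEMENT of `υ_δ` with `c(t n δ)` on `F′ₙ` (TWa) — everything L5b/L6 consume;
* `rep_twistedSum_eq_of_agree`: `rep n x′ = (1 ⊗ ∏_δ ((c(t n δ)) θu n)^{k_δ})^{48}` for the twisted sum `x′ = Σ k_δ • υ_δ(48 • θraw)`.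
HONEST LABEL: Galois/character bookkeeping; theorems only (no definition, no named fact, no instance, no sorry); nothing closes;
(B2′) NOT proved here; stmt-BirchSwinnertonDyer-19945 OPEN; BSD claimed for no curve.

## References
* K. Kato, Astérisque 295 (2004), §15.5–§15.6 (pp. 253–254), 15.14 (p. 264). [Kato2004Asterisque]
* T. Tsuji, J. Number Theory 78 (1999), §2 Lemma 2.1 (pp. 3–4), §3 (pp. 5–6), §4 (p. 12). [Tsuji1999]
* K. Ireland, M. Rosen, *A Classical Introduction to Modern Number Theory* (1990), Prop. 5.1.2 (Euler), Ch. 6 §3. [IrelandRosen1990]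
* S. Lang, *Cyclotomic Fields I–II* (1990), Ch. 10 §1 (PDF p. 167). [Lang1990]
-/

noncomputable section

open scoped NumberField
open Field
open Literature.NumberTheory.IwasawaTheory
open Literature.NumberTheory.GaloisRepresentations Literature.NumberTheory.GaloisRepresentations.LocalWeilDatum
open Literature.NumberTheory.EllipticCurves
open Literature.NumberTheory.ComplexMultiplication.EllipticUnits
open Summit.BirchSwinnertonDyer.BirchSwinnertonDyer.Theorems.PrintCf2.LeopoldtAtV

namespace Summit.BirchSwinnertonDyer.Rank1Residual.Additive.GenusSeven

namespace GenusFrame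

variable (F : GenusFrame) {Kcm : Type} [Field Kcm] [NumberField Kcm]
  (e : AlgebraicClosure Kcm →+* AlgebraicClosure ℚ) {c : absoluteGaloisGroup Kcm →* absoluteGaloisGroup ℚ}

/-! ## §4 The unit weight; ★★★ the twist data; the twisted sum on `𝓤_{F′ₙ}` (sections §1–§3 are File TWa) -/

/-- `IsUnit x ↔ x mod 7 ≠ 0` in `ℤ₇`. [cite: Lang1990, Ch. 10 §1 (PDF p. 167)] -/
theorem isUnit_of_toZMod_ne_zero {x : ℤ_[7]} (hx : PadicInt.toZMod x ≠ 0) : IsUnit x := by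
  haveI : Fact (Nat.Prime 7) := ⟨Nat.prime_seven⟩
  by_contra hu
  exact hx (by rwa [← RingHom.mem_ker, PadicInt.ker_toZMod, IsLocalRing.mem_maximalIdeal, mem_nonunits_iff])

/-- **THE UNIT WEIGHT.**  For exponents `aᵢ` prime to `7|D|` with `(aᵢ|7) = 1`, inverses `bᵢaᵢ ≡ 1 (7)`, weights
`kᵢ = bᵢ·cᵢ` with `cᵢ = (χ_D(aᵢ)ω(aᵢ)⁵ mod 7)` and values `tᵢ = χ_D(aᵢ)ω(aᵢ)⁵`: every term `kᵢtᵢ ≡ bᵢχ_D(aᵢ)²aᵢ^{10} ≡ aᵢ⁹ ≡ aᵢ³ ≡ (aᵢ|7) = 1`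
(`χ_D² = 1`, `ω(a) ≡ a`, `a⁶ ≡ 1`, Euler's criterion), so `Σ kᵢtᵢ ≡ #ι (mod 7)` is a unit of `ℤ₇` when `7 ∤ #ι`.
[cite: IrelandRosen1990, Prop. 5.1.2 (Euler's criterion)] [cite: Lang1990, Ch. 10 §1 (PDF p. 167, ω)] [cite: Tsuji1999, §2 Lemma 2.1 (pp. 3–4)] -/
theorem isUnit_sum_weights {ι : Type} [Fintype ι] (hι : ¬ 7 ∣ Fintype.card ι) {A B k : ι → ℕ} {t : ι → ℤ_[7]}
    (hAcop : ∀ i, (A i).Coprime (7 * F.d)) (hjac : ∀ i, jacobiSym (A i) 7 = 1) (hB : ∀ i, B i * A i ≡ 1 [MOD 7])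
    (hk : ∀ i, k i = B i * (PadicInt.toZMod (F.χD (A i : ZMod F.d) * F.ω (A i : ZMod 7) ^ 5)).val)
    (ht : ∀ i, t i = F.χD (A i : ZMod F.d) * F.ω (A i : ZMod 7) ^ 5) :
    IsUnit (∑ i, (k i : ℤ_[7]) * t i) := by
  haveI : Fact (Nat.Prime 7) := ⟨Nat.prime_seven⟩
  haveI : NeZero F.d := ⟨F.d_ne_zero⟩
  apply isUnit_of_toZMod_ne_zero
  have hterm : ∀ i, PadicInt.toZMod ((k i : ℤ_[7]) * t i) = 1 := by
    intro i
    have hA7 : (A i).Coprime 7 := Nat.Coprime.coprime_mul_right_right (hAcop i)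
    have hAd : (A i).Coprime F.d := Nat.Coprime.coprime_mul_left_right (hAcop i)
    -- `ω(a) ≡ a`, `χ_D(a)² = 1`, `b a ≡ 1`, `a³ ≡ (a|7) = 1`
    have hω : PadicInt.toZMod (F.ω (A i : ZMod 7)) = (A i : ZMod 7) := by
      have h := F.ω_teichmuller (ZMod.unitOfCoprime (A i) hA7)
      rwa [ZMod.coe_unitOfCoprime] at h
    have hχ : F.χD (A i : ZMod F.d) * F.χD (A i : ZMod F.d) = 1 := by
      have hu : IsUnit ((A i : ℕ) : ZMod F.d) := by
        rw [← ZMod.coe_unitOfCoprime (A i) hAd]; exact Units.isUnit _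
      rw [← MulChar.mul_apply, F.χD_mul_self, MulChar.one_apply hu]
    have hBA : (B i : ZMod 7) * (A i : ZMod 7) = 1 := by
      have := (ZMod.natCast_eq_natCast_iff _ _ 7).mpr (hB i)
      push_cast at this
      exact this
    have hA3 : (A i : ZMod 7) ^ 3 = 1 := by
      have h := legendreSym.eq_pow 7 (A i : ℤ)
      rw [jacobiSym.legendreSym.to_jacobiSym, hjac i] at h
      push_cast at h
      exact h.symm
    have hχ' : PadicInt.toZMod (F.χD (A i : ZMod F.d)) ^ 2 = 1 := by rw [sq, ← map_mul, hχ, map_one]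
    rw [hk i, ht i]
    simp only [map_mul, map_pow, map_natCast, Nat.cast_mul, ZMod.natCast_zmod_val, hω]
    linear_combination (PadicInt.toZMod (F.χD (A i : ZMod F.d)) ^ 2 * (A i : ZMod 7) ^ 9) * hBA +
      (PadicInt.toZMod (F.χD (A i : ZMod F.d)) ^ 2 * ((A i : ZMod 7) ^ 6 + (A i : ZMod 7) ^ 3 + 1)) * hA3 + hχ'
  rw [map_sum, Finset.sum_congr rfl fun i _ ↦ hterm i, Finset.sum_const, Finset.card_univ, nsmul_eq_mul, mul_one]
  exact fun h ↦ hι ((ZMod.natCast_eq_zero_iff _ _).mp h)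

/-- ★★★ **THE TWIST DATA over `ι = Γ_K/H₀`.**  Under (A0) (`K_cyc` cyclotomic), (A1) (`s² = −7`), `[Γ_K : H₀] < ∞`, and with `ζ′₀ ∈ K̄`,
`e ζ′₀ = ζsys 0`, primitive of order `7|D|`: there are exponents `a_δ` (`(out δ) ζ′₀ = ζ′₀^{a_δ}`, prime to `7|D|`, `(a_δ|7) = 1`),
inverses `b_δ` (`b_δa_δ ≡ 1 (7)`), weights `k_δ = b_δ·(χ_D(a_δ)ω(a_δ)⁵ mod 7)`, torsion lifts `υ_δ ∈ Υ` (`η₁(υ_δ) = χ_D(a_δ)ω(a_δ)⁵`,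
`χ₇(υ_δ) = ω(a_δ)`, `υ_δ` acts by `a_δ` on `μ_{|D|}` and `μ₇`) and, for EVERY level `n`, representatives `t n δ ∈ Uₙ` of the classes `δ`
(`(out δ)⁻¹·t n δ ∈ H₀`) such that: the weight `Σ_δ k_δ η₁(υ_δ)` is a UNIT of `ℤ₇` (`≡ [Γ_K:H₀] ≢ 0 (7)`, A2b (A2)), and `υ_δ` AGREES WITH
`c(t n δ)` ON `F′ₙ` for all `n, δ`. [cite: Kato2004Asterisque, 15.14 (p. 264)] [cite: Tsuji1999, §3 (pp. 5–6) and §4 (p. 12)]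
[cite: IrelandRosen1990, Prop. 5.1.2 and Ch. 6 §3] -/
theorem exists_twistData
    (hc : ∀ (σ : absoluteGaloisGroup Kcm) (z : AlgebraicClosure Kcm), e (σ • z) = c σ • e z)
    (hbij : Function.Bijective e) (h2 : Module.finrank ℚ Kcm = 2) {s : Kcm} (hs : s ^ 2 = -7) (K : ZpExtension ℚ 7)
    (hK : K.IsCyclotomic) [Fintype (absoluteGaloisGroup Kcm ⧸ layerFixing F e 0)]
    {ζ₀' : AlgebraicClosure Kcm} (hζ₀' : IsPrimitiveRoot ζ₀' (7 * F.d)) :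
    ∃ (A B k : absoluteGaloisGroup Kcm ⧸ layerFixing F e 0 → ℕ)
      (υ : absoluteGaloisGroup Kcm ⧸ layerFixing F e 0 → torsionCyclotomicSubgroup 7)
      (t : ℕ → absoluteGaloisGroup Kcm ⧸ layerFixing F e 0 → absoluteGaloisGroup Kcm),
      (∀ n δ, t n δ ∈ (K.restrictOfFinrankEqTwo (by decide) Kcm h2).layerSubgroup n) ∧
      (∀ n δ, (Quotient.out δ)⁻¹ * t n δ ∈ layerFixing F e 0) ∧
      (∀ n δ, (t n δ : absoluteGaloisGroup Kcm ⧸ layerFixing F e 0) = δ) ∧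
      (∀ δ, Quotient.out δ • ζ₀' = ζ₀' ^ A δ) ∧
      (∀ δ, (A δ).Coprime (7 * F.d)) ∧ (∀ δ, jacobiSym (A δ) 7 = 1) ∧ (∀ δ, B δ * A δ ≡ 1 [MOD 7]) ∧
      (∀ δ, k δ = B δ * (PadicInt.toZMod (F.χD (A δ : ZMod F.d) * F.ω (A δ : ZMod 7) ^ 5)).val) ∧
      (∀ δ, ((F.η₁ (υ δ) : ℤ_[7]ˣ) : ℤ_[7]) = F.χD (A δ : ZMod F.d) * F.ω (A δ : ZMod 7) ^ 5) ∧
      (∀ δ (ζ : AlgebraicClosure ℚ), ζ ^ 7 = 1 → ((υ δ : torsionCyclotomicSubgroup 7) : absoluteGaloisGroup ℚ) • ζ = ζ ^ A δ) ∧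
      IsUnit (∑ δ, (k δ : ℤ_[7]) * ((F.η₁ (υ δ) : ℤ_[7]ˣ) : ℤ_[7])) ∧
      (∀ n δ (y : AlgebraicClosure ℚ), y ∈ F.layer n →
        ((υ δ : torsionCyclotomicSubgroup 7) : absoluteGaloisGroup ℚ) • y = c (t n δ) • y) := by
  haveI : Fact (Nat.Prime 7) := ⟨Nat.prime_seven⟩
  haveI : NeZero F.d := ⟨F.d_ne_zero⟩
  haveI : NeZero (7 * F.d) := ⟨mul_ne_zero (by norm_num) F.d_ne_zero⟩
  haveI : NeZero (7 : ℕ) := ⟨by norm_num⟩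
  haveI : (layerFixing F e 0).FiniteIndex := Subgroup.finiteIndex_of_finite_quotient
  -- representatives in `Uₙ` of the `H₀`-cosets
  have hrep : ∀ (n : ℕ) (δ : absoluteGaloisGroup Kcm ⧸ layerFixing F e 0),
      ∃ u ∈ (K.restrictOfFinrankEqTwo (by decide) Kcm h2).layerSubgroup n, u⁻¹ * Quotient.out δ ∈ layerFixing F e 0 :=
    fun n δ ↦ F.exists_mem_layerSubgroup_inv_mul_mem e h2 K hc hbij n _
  choose t htU htH using hrep
  have htH' : ∀ n δ, (Quotient.out δ)⁻¹ * t n δ ∈ layerFixing F e 0 := fun n δ ↦ by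
    have h := (layerFixing F e 0).inv_mem (htH n δ)
    rwa [mul_inv_rev, inv_inv] at h
  -- exponents of the canonical representatives on `ζ′₀`, inverses mod `7`, torsion lifts
  have hexp : ∀ δ : absoluteGaloisGroup Kcm ⧸ layerFixing F e 0, ∃ a : ℕ, a.Coprime (7 * F.d) ∧ Quotient.out δ • ζ₀' = ζ₀' ^ a :=
    fun δ ↦ exists_smul_eq_pow_of_isPrimitiveRoot hζ₀' _
  choose A hAcop hA using hexp
  have hA7 : ∀ δ, (A δ).Coprime 7 := fun δ ↦ Nat.Coprime.coprime_mul_right_right (hAcop δ)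
  have hinv : ∀ δ : absoluteGaloisGroup Kcm ⧸ layerFixing F e 0, ∃ b : ℕ, b * A δ ≡ 1 [MOD 7] := fun δ ↦ by
    have hb : ((((ZMod.unitOfCoprime (A δ) (hA7 δ))⁻¹ : (ZMod 7)ˣ).val.val : ZMod 7) * (A δ : ZMod 7) = 1) := by
      rw [ZMod.natCast_zmod_val, ← ZMod.coe_unitOfCoprime (A δ) (hA7 δ), ← Units.val_mul, inv_mul_cancel, Units.val_one]
    refine ⟨((ZMod.unitOfCoprime (A δ) (hA7 δ))⁻¹ : (ZMod 7)ˣ).val.val, (ZMod.natCast_eq_natCast_iff _ _ _).mp ?_⟩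
    rw [Nat.cast_mul, Nat.cast_one, hb]
  choose B hB using hinv
  have hlift := fun δ ↦ F.exists_torsionLift_eta (hAcop δ)
  choose υ hυχ hυd hυ7 hυη using hlift
  -- `(a_δ|7) = 1` (A2a, on the primitive 7th root `ζ′₀^{|D|}`)
  have hζ7 : IsPrimitiveRoot (ζ₀' ^ F.d) 7 := hζ₀'.pow (NeZero.pos _) (mul_comm _ _)
  have hjac : ∀ δ, jacobiSym (A δ) 7 = 1 := fun δ ↦
    jacobiSym_eq_one_of_smul_eq_pow e hc hs hζ7
      (smul_eq_pow_of_smul_eq_pow_of_dvd hζ₀' (hA δ) (dvd_refl _) _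
        (by rw [← pow_mul, mul_comm, pow_mul, hζ₀'.pow_eq_one, one_pow]))
  refine ⟨A, B, fun δ ↦ B δ * (PadicInt.toZMod (F.χD (A δ : ZMod F.d) * F.ω (A δ : ZMod 7) ^ 5)).val, υ, t, htU, htH', ?_, hA,
    hAcop, hjac, hB, fun δ ↦ rfl, hυη, hυ7, ?_, fun n δ y hy ↦ ?_⟩
  · -- classes
    intro n δ
    have h : ((t n δ : absoluteGaloisGroup Kcm) : absoluteGaloisGroup Kcm ⧸ layerFixing F e 0) =
        (Quotient.out δ : absoluteGaloisGroup Kcm) := QuotientGroup.eq.mpr (htH n δ)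
    rw [h, QuotientGroup.out_eq']
  · -- the unit weight: `#(Γ_K/H₀) = [Γ_K : H₀]` is prime to `7`
    refine F.isUnit_sum_weights ?_ hAcop hjac hB (fun δ ↦ rfl) hυη
    rw [← Nat.card_eq_fintype_card, ← Subgroup.index_eq_card]
    exact F.not_seven_dvd_index_layerFixing_zero e hc hbij
  · -- agreement on `F′ₙ`
    exact F.forall_smul_eq_transport_smul e h2 K hc hbij hK n (htU n δ) (htH' n δ) hζ₀' (hAcop δ) (hA δ) (hυχ δ) (hυd δ) y hy

/-- Galois conjugates of the global units `θu n ∈ E(F′ₙ)` are global units of `F′ₙ` (`F′ₙ/ℚ` is normal).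
[cite: Tsuji1999, §3 (p. 5)] -/
theorem galUnits_mem_layer (n : ℕ) (σ : absoluteGaloisGroup ℚ) (u : globalUnitsOf (F.layer n)) :
    galUnits σ (u : (AlgebraicClosure ℚ)ˣ) ∈ globalUnitsOf (F.layer n) :=
  @galUnits_mem_globalUnitsOf ℚ _ (F.layer n) (F.normal_layer n) σ u

/-- Power bookkeeping in the semi-local units: `(1 ⊗ g)^{48})^k = (1 ⊗ g^k)^{48}`. [cite: Tsuji1999, §3 (p. 5)] -/
theorem globalToSemilocalUnits_pow_pow (n : ℕ) (g : globalUnitsOf (F.layer n)) (k : ℕ) :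
    (globalToSemilocalUnits F.v (F.layer n) g ^ 48) ^ k = globalToSemilocalUnits F.v (F.layer n) (g ^ k) ^ 48 := by
  rw [map_pow, ← pow_mul, ← pow_mul, mul_comm]

/-- **The twisted sum on `𝓤_{F′ₙ}`**: if every `υᵢ` agrees with `σᵢ ∈ Γ_ℚ` on `F′ₙ`, then
`rep n (Σᵢ kᵢ • υᵢ(48 • θraw)) = (1 ⊗ ∏ᵢ (σᵢ θu n)^{kᵢ})^{48}` (the `48`-th power of the twisted norm of the elliptic family, as a global
unit of `F′ₙ`). [cite: Kato2004Asterisque, §15.5–§15.6 (pp. 253–254) and 15.14 (p. 264)] [cite: Tsuji1999, §3 (p. 5)] -/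
theorem rep_twistedSum_eq_of_agree {θu : ∀ n : ℕ, globalUnitsOf (F.layer n)} (dat : GenusDatum F θu) {ι : Type} [Fintype ι]
    (υ : ι → torsionCyclotomicSubgroup 7) (k : ι → ℕ) (n : ℕ) {σ : ι → absoluteGaloisGroup ℚ}
    (hagree : ∀ i (y : AlgebraicClosure ℚ), y ∈ F.layer n → ((υ i : torsionCyclotomicSubgroup 7) : absoluteGaloisGroup ℚ) • y = σ i • y) :
    F.U.rep n (dat.twistedSum υ (fun _ ↦ 0) k) =
      globalToSemilocalUnits F.v (F.layer n)
        (∏ i, (⟨galUnits (σ i) (θu n : (AlgebraicClosure ℚ)ˣ), F.galUnits_mem_layer n (σ i) (θu n)⟩ : globalUnitsOf (F.layer n)) ^ k i) ^ 48 := by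
  have hi : ∀ i, F.U.rep n (k i • F.U.act (υ i) ((1 + PowerSeries.X : IwasawaAlgebra 7) ^ 0 • (48 • dat.θraw))) =
      globalToSemilocalUnits F.v (F.layer n)
        ((⟨galUnits (σ i) (θu n : (AlgebraicClosure ℚ)ˣ), F.galUnits_mem_layer n (σ i) (θu n)⟩ : globalUnitsOf (F.layer n)) ^ k i) ^ 48 := by
    intro i
    rw [F.rep_nsmul, F.rep_act_one_add_X_pow_smul_eq_of_agree (υ i) n 0 (σ := σ i)
      (fun y hy ↦ by rw [pow_zero, mul_one]; exact hagree i y hy) (dat.θraw_rep n)]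
    exact F.globalToSemilocalUnits_pow_pow n _ (k i)
  rw [GenusDatum.twistedSum_def, F.rep_sum, Finset.prod_congr rfl fun i _ ↦ hi i]
  exact (Finset.prod_pow _ 48 _).trans (congrArg (· ^ 48) (map_prod (globalToSemilocalUnits F.v (F.layer n)) _ _).symm)

end GenusFrame

end Summit.BirchSwinnertonDyer.Rank1Residual.Additive.GenusSeven

end
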